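import Mathlib.CategoryTheory.Abelian.Ext
import Mathlib.Algebra.Homology.Opposite
import Mathlib.RepresentationTheory.Homological.GroupCohomology.Shapiro
import Mathlib.RepresentationTheory.Homological.GroupCohomology.Functoriality
import HarnessLib

/-!
# Shapiro's isomorphism is natural in the coefficient module

Topic `Algebra/Homology`; namespace `Literature.Algebra.Homology`.  A *proofs* file (one auxiliary
definition with body, theorems; no named fact, no instance) supplementing Mathlib's Shapiro lemma
`groupCohomology.coindIso A n : Hⁿ(G, Coind_S^G A) ≅ Hⁿ(S, A)`
(`Mathlib/RepresentationTheory/Homological/GroupCohomology/Shapiro.lean`), which is constructed from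
`Ext`-isomorphisms through projective resolutions but comes with no naturality statement.  We prove
that it is NATURAL in the `S`-representation `A` (`coindIso_hom_naturality`): for `φ : A ⟶ B`,

  `Hⁿ(G, Coind φ) ≫ coindIso B = coindIso A ≫ Hⁿ(S, φ)`,

so that `coindIso` transports module structures given by endomorphisms of `A` (e.g. Hecke operators
acting on coefficient modules of arithmetic quotients, `Literature/NumberTheory/Automorphic/
BoundaryShapiro.lean`) — "the isomorphism of Shapiro's lemma is natural" [Brown1982CohomologyGroups,
III §6, (6.2) and Ex. 2 to §8].  The proof follows the construction of `coindIso`: naturality of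

* `groupCohomology.inhomogeneousCochainsIso A : C•(G, A) ≅ Hom(bar_G, A)` in `A`
  (`inhomogeneousCochainsIso_hom_naturality`, componentwise: `freeLift (φ ∘ x) = freeLift x ≫ φ`);
* `groupCohomology.linearYonedaObjResProjectiveResolutionIso P A : Hom(Res P, A) ≅ Hom(P, Coind A)`
  in `A` (`linearYonedaObjResProjectiveResolutionIso_hom_naturality`, the `res ⊣ coind` adjunction);
* `CategoryTheory.ProjectiveResolution.isoExt P n Y : Extⁿ(X, Y) ≅ Hⁿ(Hom(P, Y))` in `Y`
  (`isoExt_hom_naturality`, from Mathlib's `ProjectiveResolution.leftDerived_app_eq` — the map of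
  `Ext` in the second variable is a component of a left-derived natural transformation — and the
  naturality of `HomologicalComplex.homologyOp`);

with `linearYonedaObjMap P f : Hom(P, Y) ⟶ Hom(P, Y')` the functoriality of
`P.complex.linearYonedaObj R Y` in `Y` (postcomposition).

## References

* K. S. Brown, *Cohomology of groups*, GTM 87 (1982), III §5–§6 (coinduced modules, Shapiro's lemma,
  (6.2)), III §8 [Brown1982CohomologyGroups].
* C. A. Weibel, *An introduction to homological algebra* (1994), §2.4–2.5 (derived functors are
  functorial in the second variable), Lemma 6.3.2 (Shapiro) [Weibel1994].
-/

noncomputable section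

open CategoryTheory Opposite

universe w v u

namespace Literature.Algebra.Homology

/-! ### `Hom(P, Y)` is functorial in `Y`; `Extⁿ(X, Y) ≅ Hⁿ(Hom(P, Y))` is natural in `Y` -/

section Ext

variable {R : Type w} [Ring R] {C : Type u} [Category.{v} C] [Abelian C] [Linear R C]
  {X : C} (P : ProjectiveResolution X)

/-- **Functoriality of `Hom(P, Y)` in `Y`.**  For a projective resolution `P` of `X` and
`f : Y ⟶ Y'`, the morphism of cochain complexes `P.complex.linearYonedaObj R Y ⟶
P.complex.linearYonedaObj R Y'` given by postcomposition with `f` (the `unop` of the value on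
`P.complex` of the natural transformation of `mapHomologicalComplex` induced by `linearYoneda.map f`).
[cite: Weibel1994, §2.5] -/
def linearYonedaObjMap {Y Y' : C} (f : Y ⟶ Y') :
    P.complex.linearYonedaObj R Y ⟶ P.complex.linearYonedaObj R Y' :=
  (HomologicalComplex.unopFunctor _ _).map
    ((NatTrans.mapHomologicalComplex (NatTrans.rightOp ((linearYoneda R C).map f))
      (ComplexShape.down ℕ)).app P.complex).op

/-- In each degree `linearYonedaObjMap P f` is postcomposition `g ↦ g ≫ f`. [folklore] -/
theorem linearYonedaObjMap_f {Y Y' : C} (f : Y ⟶ Y') (i : ℕ) :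
    (linearYonedaObjMap (R := R) P f).f i = ModuleCat.ofHom (Linear.rightComp R _ f) :=
  rfl

variable [EnoughProjectives C]

/-- **`Extⁿ(X, Y) ≅ Hⁿ(Hom(P, Y))` is natural in `Y`** (left-derived form): the component at `X` of
the left-derived natural transformation induced by `f : Y ⟶ Y'` corresponds, under Mathlib's
`ProjectiveResolution.isoExt`, to the map on homology induced by postcomposition with `f`.
(Mathlib's `leftDerived_app_eq` computes the former through the resolution `P`; the comparison of
`Hⁿ` of a complex in `(ModuleCat R)ᵒᵖ` with `Hⁿ` of its `unop` is natural,
`HomologicalComplex.homologyOp_hom_naturality`.) [cite: Weibel1994, §2.4–2.5] -/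
theorem isoExt_hom_naturality' {Y Y' : C} (f : Y ⟶ Y') (n : ℕ) :
    ((NatTrans.leftDerived (NatTrans.rightOp ((linearYoneda R C).map f)) n).app X).unop ≫
        (P.isoExt n Y').hom =
      (P.isoExt n Y).hom ≫ HomologicalComplex.homologyMap (linearYonedaObjMap P f) n := by
  rw [ProjectiveResolution.leftDerived_app_eq _ P n]
  simp only [ProjectiveResolution.isoExt, Iso.trans_hom, Iso.symm_hom, Iso.unop_inv, unop_comp,
    Category.assoc]
  have hcancel : ∀ {Z : ModuleCat R} (h : _ ⟶ Z),
      (P.isoLeftDerivedObj ((linearYoneda R C).obj Y').rightOp n).hom.unop ≫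
        (P.isoLeftDerivedObj ((linearYoneda R C).obj Y').rightOp n).inv.unop ≫ h = h := fun h => by
    rw [← Category.assoc, ← unop_comp, Iso.inv_hom_id, unop_id, Category.id_comp]
  erw [hcancel]
  congr 1
  apply Quiver.Hom.op_inj
  simp only [op_comp, Quiver.Hom.op_unop, HomologicalComplex.homologyUnop, Iso.unop_inv]
  change (((((linearYoneda R C).obj Y').rightOp.mapHomologicalComplex _).obj P.complex).unop.homologyOp
        n).inv ≫
      (HomologicalComplex.homologyFunctor _ _ n).map
        ((NatTrans.mapHomologicalComplex (NatTrans.rightOp ((linearYoneda R C).map f)) _).app P.complex) =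
    (HomologicalComplex.homologyMap (linearYonedaObjMap P f) n).op ≫
      (((((linearYoneda R C).obj Y).rightOp.mapHomologicalComplex _).obj P.complex).unop.homologyOp n).inv
  have h2 : (HomologicalComplex.homologyFunctor _ _ n).map
        ((NatTrans.mapHomologicalComplex (NatTrans.rightOp ((linearYoneda R C).map f)) _).app P.complex) ≫
      (((((linearYoneda R C).obj Y).rightOp.mapHomologicalComplex _).obj P.complex).unop.homologyOp n).hom =
      (((((linearYoneda R C).obj Y').rightOp.mapHomologicalComplex _).obj P.complex).unop.homologyOp n).hom ≫
        (HomologicalComplex.homologyMap (linearYonedaObjMap P f) n).op :=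
    HomologicalComplex.homologyOp_hom_naturality (linearYonedaObjMap (R := R) P f) n
  exact (Iso.eq_comp_inv _).mpr ((Category.assoc _ _ _).trans ((Iso.inv_comp_eq _).mpr h2))

/-- **`Extⁿ(X, Y) ≅ Hⁿ(Hom(P, Y))` (Mathlib `ProjectiveResolution.isoExt`) is natural in `Y`**: for
`f : Y ⟶ Y'`, `Extⁿ(X, f) ≫ isoExt P n Y' = isoExt P n Y ≫ Hⁿ(Hom(P, f))`. [cite: Weibel1994, §2.4–2.5] -/
theorem isoExt_hom_naturality {Y Y' : C} (f : Y ⟶ Y') (n : ℕ) :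
    ((Ext R C n).obj (op X)).map f ≫ (P.isoExt n Y').hom =
      (P.isoExt n Y).hom ≫ HomologicalComplex.homologyMap (linearYonedaObjMap P f) n :=
  isoExt_hom_naturality' P f n

end Ext

/-! ### Group cohomology: the comparison isomorphisms are natural in the representation -/

section GroupCohomology

open groupCohomology Rep

variable {k G : Type u} [CommRing k] [Group G]

/-- **`C•(G, A) ≅ Hom(bar_G, A)` is natural in `A`**: Mathlib's `inhomogeneousCochainsIso` commutes
with `cochainsMap (MonoidHom.id G) φ` and postcomposition with `φ` (in degree `i` both send a cochain
`x : Gⁱ → A` to the morphism `k[Gⁱ⁺¹] ⟶ B` freely extending `φ ∘ x`). [folklore] -/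
theorem inhomogeneousCochainsIso_hom_naturality {A B : Rep k G} (φ : A ⟶ B) :
    cochainsMap (MonoidHom.id G) φ ≫ (inhomogeneousCochainsIso B).hom =
      (inhomogeneousCochainsIso A).hom ≫ linearYonedaObjMap (Rep.barResolution k G) φ := by
  refine HomologicalComplex.hom_ext _ _ fun i => ?_
  simp only [HomologicalComplex.comp_f, inhomogeneousCochainsIso,
    HomologicalComplex.Hom.isoOfComponents_hom_f]
  refine ModuleCat.hom_ext (LinearMap.ext fun x => ?_)
  change (Rep.freeLiftLEquiv k G (Fin i → G) B).symm (φ.hom ∘ x) =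
    (Rep.freeLiftLEquiv k G (Fin i → G) A).symm x ≫ φ
  apply Rep.free_ext
  intro j
  change B.ρ.freeLift (φ.hom ∘ x) (Finsupp.single j (MonoidAlgebra.single 1 1)) =
    φ.hom (A.ρ.freeLift x (Finsupp.single j (MonoidAlgebra.single 1 1)))
  rw [Representation.freeLift_single_single, Representation.freeLift_single_single]
  simp

/-- **`Hom(Res_S P, A) ≅ Hom(P, Coind_S^G A)` is natural in `A`** (the `res ⊣ coind` adjunction,
Mathlib's `linearYonedaObjResProjectiveResolutionIso`). [folklore] -/
theorem linearYonedaObjResProjectiveResolutionIso_hom_naturality {S : Subgroup G}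
    (P : ProjectiveResolution (Rep.trivial k G k)) {A B : Rep.{u} k S} (φ : A ⟶ B) :
    linearYonedaObjMap ((resFunctor S.subtype).mapProjectiveResolution P) φ ≫
        (linearYonedaObjResProjectiveResolutionIso P B).hom =
      (linearYonedaObjResProjectiveResolutionIso P A).hom ≫
        linearYonedaObjMap P ((coindFunctor k S.subtype).map φ) := by
  refine HomologicalComplex.hom_ext _ _ fun i => ?_
  simp only [HomologicalComplex.comp_f, linearYonedaObjResProjectiveResolutionIso,
    HomologicalComplex.Hom.isoOfComponents_hom_f, linearYonedaObjMap_f]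
  refine ModuleCat.hom_ext (LinearMap.ext fun g => ?_)
  change resCoindHomEquiv S.subtype (P.complex.X i) B (g ≫ φ) =
    resCoindHomEquiv S.subtype (P.complex.X i) A g ≫ (coindFunctor k S.subtype).map φ
  ext
  rfl

set_option backward.isDefEq.respectTransparency false in
-- (as in Mathlib's `Shapiro.lean`: the pieces of `coindIso` are typed through `groupCohomology`,
-- `(barResolution k G).complex` and `Ext`, which agree with their unfoldings only definitionally)
/-- **Shapiro's isomorphism is natural in the representation.**  For a subgroup `S ≤ G` and a
morphism `φ : A ⟶ B` of `S`-representations, Mathlib's `groupCohomology.coindIso` satisfies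
`Hⁿ(G, Coind_S^G φ) ≫ coindIso B n = coindIso A n ≫ Hⁿ(S, φ)`.
[cite: Brown1982CohomologyGroups, III §6 (6.2)] -/
theorem coindIso_hom_naturality {S : Subgroup G} {A B : Rep.{u} k S} (φ : A ⟶ B) (n : ℕ) :
    groupCohomology.map (MonoidHom.id G) (Rep.coindMap S.subtype φ) n ≫
        (groupCohomology.coindIso B n).hom =
      (groupCohomology.coindIso A n).hom ≫ groupCohomology.map (MonoidHom.id S) φ n := by
  simp only [groupCohomology.coindIso, groupCohomologyIso, groupCohomologyIsoExt,
    Rep.barResolution.extIso, Iso.trans_hom, Iso.trans_inv, Iso.symm_hom, Iso.symm_inv,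
    Functor.mapIso_hom, HomologicalComplex.homologyFunctor_map, Category.assoc,
    HomologicalComplex.homologyMap_comp]
  -- the five commuting squares, from left to right
  have s1 : HomologicalComplex.homologyMap (cochainsMap (MonoidHom.id G) (Rep.coindMap S.subtype φ)) n ≫
      HomologicalComplex.homologyMap (inhomogeneousCochainsIso (coind S.subtype B)).hom n =
      HomologicalComplex.homologyMap (inhomogeneousCochainsIso (coind S.subtype A)).hom n ≫
        HomologicalComplex.homologyMap (linearYonedaObjMap (Rep.barResolution k G)
          (Rep.coindMap S.subtype φ)) n := by
    rw [← HomologicalComplex.homologyMap_comp, ← HomologicalComplex.homologyMap_comp,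
      inhomogeneousCochainsIso_hom_naturality]
  have s2 : HomologicalComplex.homologyMap (linearYonedaObjMap (Rep.barResolution k G)
          (Rep.coindMap S.subtype φ)) n ≫
      HomologicalComplex.homologyMap
        (linearYonedaObjResProjectiveResolutionIso (Rep.barResolution k G) B).inv n =
      HomologicalComplex.homologyMap
        (linearYonedaObjResProjectiveResolutionIso (Rep.barResolution k G) A).inv n ≫
      HomologicalComplex.homologyMap (linearYonedaObjMap ((resFunctor S.subtype).mapProjectiveResolution
        (Rep.barResolution k G)) φ) n := by
    rw [← HomologicalComplex.homologyMap_comp, ← HomologicalComplex.homologyMap_comp]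
    -- both composites of complexes agree definitionally (`res ⊣ coind` is componentwise `rfl`)
    congr 1
  have s3 : HomologicalComplex.homologyMap (linearYonedaObjMap
        ((resFunctor S.subtype).mapProjectiveResolution (Rep.barResolution k G)) φ) n ≫
      (((resFunctor S.subtype).mapProjectiveResolution (Rep.barResolution k G)).isoExt n B).inv =
      (((resFunctor S.subtype).mapProjectiveResolution (Rep.barResolution k G)).isoExt n A).inv ≫
        ((Ext k (Rep.{u} k S) n).obj (op ((resFunctor S.subtype).obj (Rep.trivial k G k)))).map φ := by
    rw [Iso.comp_inv_eq, Category.assoc, Iso.eq_inv_comp, isoExt_hom_naturality]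
  have s4 : ((Ext k (Rep.{u} k S) n).obj (op ((resFunctor S.subtype).obj (Rep.trivial k G k)))).map φ ≫
      ((Rep.barResolution k S).isoExt n B).hom =
      ((Rep.barResolution k S).isoExt n A).hom ≫
        HomologicalComplex.homologyMap (linearYonedaObjMap (Rep.barResolution k S) φ) n :=
    isoExt_hom_naturality (Rep.barResolution k S) φ n
  have s5 : HomologicalComplex.homologyMap (linearYonedaObjMap (Rep.barResolution k S) φ) n ≫
      (isoOfQuasiIsoAt (HomotopyEquiv.ofIso (inhomogeneousCochainsIso B)).hom n).inv =
      (isoOfQuasiIsoAt (HomotopyEquiv.ofIso (inhomogeneousCochainsIso A)).hom n).inv ≫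
        groupCohomology.map (MonoidHom.id S) φ n := by
    rw [Iso.comp_inv_eq, Category.assoc, Iso.eq_inv_comp, isoOfQuasiIsoAt_hom, isoOfQuasiIsoAt_hom]
    change HomologicalComplex.homologyMap (inhomogeneousCochainsIso A).hom n ≫ _ =
      HomologicalComplex.homologyMap (cochainsMap (MonoidHom.id S) φ) n ≫
        HomologicalComplex.homologyMap (inhomogeneousCochainsIso B).hom n
    rw [← HomologicalComplex.homologyMap_comp, ← HomologicalComplex.homologyMap_comp,
      inhomogeneousCochainsIso_hom_naturality]
  rw [reassoc_of% s1, reassoc_of% s2, reassoc_of% s3, reassoc_of% s4, s5]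

/-- Naturality of the inverse Shapiro isomorphism: `Hⁿ(S, φ) ≫ (coindIso B)⁻¹ = (coindIso A)⁻¹ ≫
Hⁿ(G, Coind φ)`. [cite: Brown1982CohomologyGroups, III §6 (6.2)] -/
theorem coindIso_inv_naturality {S : Subgroup G} {A B : Rep.{u} k S} (φ : A ⟶ B) (n : ℕ) :
    groupCohomology.map (MonoidHom.id S) φ n ≫ (groupCohomology.coindIso B n).inv =
      (groupCohomology.coindIso A n).inv ≫
        groupCohomology.map (MonoidHom.id G) (Rep.coindMap S.subtype φ) n := by
  rw [Iso.comp_inv_eq, Category.assoc, Iso.eq_inv_comp, coindIso_hom_naturality]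

/-- Element form: for `x ∈ Hⁿ(G, Coind_S^G A)`, `coindIso B (Hⁿ(Coind φ) x) = Hⁿ(φ) (coindIso A x)`.
[cite: Brown1982CohomologyGroups, III §6 (6.2)] -/
theorem coindIso_hom_naturality_apply {S : Subgroup G} {A B : Rep.{u} k S} (φ : A ⟶ B) (n : ℕ)
    (x : groupCohomology (coind S.subtype A) n) :
    (groupCohomology.coindIso B n).hom
        (groupCohomology.map (MonoidHom.id G) (Rep.coindMap S.subtype φ) n x) =
      groupCohomology.map (MonoidHom.id S) φ n ((groupCohomology.coindIso A n).hom x) := by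
  change (groupCohomology.map (MonoidHom.id G) (Rep.coindMap S.subtype φ) n ≫
      (groupCohomology.coindIso B n).hom) x =
    ((groupCohomology.coindIso A n).hom ≫ groupCohomology.map (MonoidHom.id S) φ n) x
  rw [coindIso_hom_naturality]

end GroupCohomology

end Literature.Algebra.Homology
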